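import Literature.Analysis.Hypoelliptic.GlobalHData
import Literature.Analysis.Hypoelliptic.Transport
import Literature.Analysis.Hypoelliptic.Gram
import Mathlib.Analysis.Calculus.BumpFunction.InnerProduct
import HarnessLib

/-!
# The data of one local chart: cutoffs, globalised fields, spanning coefficients

Analysis/Hypoelliptic support file serving the discharge of
`Literature.Analysis.Distribution.Hormander1967_thm11` (the construction behind
`GlobalHData.GData` for one chart on the Fourier model space `V`).

Given smooth vector fields `X_i` (`i : Fin K`), `X₀` and a smooth function `c` on `V`, a centre
`y₀` and a radius `δ > 0`, we build the cutoffs `χ` (`= 1` on `closedBall y₀ 3δ`, supported in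
`ball y₀ 4δ`) and `χ̃` (`= 1` on `closedBall y₀ δ`, supported in `ball y₀ 2δ`), the coefficient
families of `χ X_i`, of the auxiliary fields `Y_l = (1 - χ̃) ∂_l`, of `-χ X₀` and of `χ c`, hence
the data `Chart.g : GData V`, and prove

* `Chart.PfV_ofReal`: on `ball y₀ δ` the globalised operator IS Hörmander's transpose:
  `PfV F = ᵗP^V F`;
* `Chart.spanData`: the spanning data of `GlobalHData` from Gram coefficients of the word
  brackets (`Gram.exists_gram`), so that `Chart.g.d.SpanHyp` holds (`Chart.spanHyp`).

## References

* L. Hörmander, Acta Math. 119 (1967), §3; M. E. Taylor, *Pseudodifferential Operators* (1981),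
  Ch. XV §1 (folklore bookkeeping).
-/

noncomputable section

open MeasureTheory Set Filter Function SchwartzMap VectorField Metric
open scoped Topology ComplexConjugate InnerProductSpace BigOperators ContDiff

namespace Literature.Analysis.Hypoelliptic

open Literature.Analysis.Distribution
open scoped Sym

variable {V : Type*} [NormedAddCommGroup V] [InnerProductSpace ℝ V] [FiniteDimensional ℝ V]

local notation "nV" => Module.finrank ℝ V

/-! ### Coefficient families from functions -/

namespace CoefFam

/-- The coefficient family of compactly supported smooth real functions plus constants. [folklore] -/
def ofFun {n : ℕ} (c : Fin n → ℝ) (f : Fin n → V → ℝ) (hf : ∀ l, ContDiff ℝ ∞ (f l))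
    (hs : ∀ l, HasCompactSupport (f l)) : CoefFam V n where
  c := c
  a := fun l => ((hs l).comp_left Complex.ofReal_zero).toSchwartzMap (Complex.ofRealCLM.contDiff.comp (hf l))
  real := fun _ _ => Complex.conj_ofReal _

omit [FiniteDimensional ℝ V] in
/-- (structural lemma) [folklore] -/
@[simp] theorem ofFun_fn {n : ℕ} (c : Fin n → ℝ) (f : Fin n → V → ℝ) (hf : ∀ l, ContDiff ℝ ∞ (f l))
    (hs : ∀ l, HasCompactSupport (f l)) (l : Fin n) (y : V) :
    (ofFun c f hf hs).fn l y = ((c l + f l y : ℝ) : ℂ) := by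
  push_cast; rfl

omit [FiniteDimensional ℝ V] in
/-- (structural lemma) [folklore] -/
@[simp] theorem ofFun_c {n : ℕ} (c : Fin n → ℝ) (f : Fin n → V → ℝ) (hf : ∀ l, ContDiff ℝ ∞ (f l))
    (hs : ∀ l, HasCompactSupport (f l)) : (ofFun c f hf hs).c = c := rfl

omit [FiniteDimensional ℝ V] in
/-- (structural lemma) [folklore] -/
theorem ofFun_a_apply {n : ℕ} (c : Fin n → ℝ) (f : Fin n → V → ℝ) (hf : ∀ l, ContDiff ℝ ∞ (f l))
    (hs : ∀ l, HasCompactSupport (f l)) (l : Fin n) (y : V) : (ofFun c f hf hs).a l y = (f l y : ℂ) := rfl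

end CoefFam

omit [FiniteDimensional ℝ V] in
/-- The real part of `vfR` of a family `c + f`: `∑_l (c_l + f_l) e_l`. [folklore] -/
theorem vfR_ofFun {n : ℕ} (e : Fin n → V) (c : Fin n → ℝ) (f : Fin n → V → ℝ) (hf : ∀ l, ContDiff ℝ ∞ (f l))
    (hs : ∀ l, HasCompactSupport (f l)) (y : V) :
    vfR e (CoefFam.ofFun c f hf hs).fn y = ∑ l, (c l + f l y) • e l := by
  simp [vfR]

/-! ### The chart -/

variable (V) in
/-- **The data of one chart**: smooth fields and zeroth-order coefficient on `V`, a centre and a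
radius, in positive dimension. [folklore] -/
structure Chart (K : ℕ) where
  /-- the sum-of-squares fields [folklore] -/
  XV : Fin K → V → V
  /-- the drift [folklore] -/
  XV0 : V → V
  /-- the zeroth-order coefficient [folklore] -/
  cV : V → ℝ
  hXV : ∀ i, ContDiff ℝ ∞ (XV i)
  hXV0 : ContDiff ℝ ∞ XV0
  hcV : ContDiff ℝ ∞ cV
  /-- the centre [folklore] -/
  y₀ : V
  /-- the radius [folklore] -/
  δ : ℝ
  hδ : 0 < δ
  pos : Module.finrank ℝ V ≠ 0

namespace Chart

variable {K : ℕ} (C : Chart V K)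

/-- The outer cutoff `χ`: `1` on `closedBall y₀ 3δ`, supported in `ball y₀ 4δ`. [folklore] -/
def χb : ContDiffBump C.y₀ := ⟨3 * C.δ, 4 * C.δ, by have := C.hδ; positivity, by have := C.hδ; linarith⟩

/-- The inner cutoff `χ̃`: `1` on `closedBall y₀ δ`, supported in `ball y₀ 2δ`. [folklore] -/
def χtb : ContDiffBump C.y₀ := ⟨C.δ, 2 * C.δ, C.hδ, by have := C.hδ; linarith⟩

/-- `χ`. [folklore] -/
def χ : V → ℝ := C.χb
/-- `χ̃`. [folklore] -/
def χt : V → ℝ := C.χtb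

/-- (structural lemma) [folklore] -/
theorem contDiff_χ : ContDiff ℝ ∞ C.χ := C.χb.contDiff
/-- (structural lemma) [folklore] -/
theorem contDiff_χt : ContDiff ℝ ∞ C.χt := C.χtb.contDiff
/-- (structural lemma) [folklore] -/
theorem hasCompactSupport_χ : HasCompactSupport C.χ := C.χb.hasCompactSupport
/-- (structural lemma) [folklore] -/
theorem hasCompactSupport_χt : HasCompactSupport C.χt := C.χtb.hasCompactSupport
/-- `χ = 1` on `ball y₀ 3δ`. [folklore] -/
theorem χ_eq_one {y : V} (hy : y ∈ ball C.y₀ (3 * C.δ)) : C.χ y = 1 :=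
  C.χb.one_of_mem_closedBall (ball_subset_closedBall hy)
/-- `χ̃ = 1` on `ball y₀ δ`. [folklore] -/
theorem χt_eq_one {y : V} (hy : y ∈ ball C.y₀ C.δ) : C.χt y = 1 :=
  C.χtb.one_of_mem_closedBall (ball_subset_closedBall hy)
/-- `tsupport χ̃ = closedBall y₀ 2δ`. [folklore] -/
theorem tsupport_χt : tsupport C.χt = closedBall C.y₀ (2 * C.δ) := C.χtb.tsupport_eq
/-- `χ̃ y ≠ 0 → y ∈ ball y₀ 2δ`. [folklore] -/
theorem mem_ball_of_χt_ne {y : V} (hy : C.χt y ≠ 0) : y ∈ ball C.y₀ (2 * C.δ) := by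
  have : y ∈ Function.support C.χt := hy
  rwa [χt, C.χtb.support_eq] at this

/-! #### The coefficient families -/

/-- The family of `χ X_i`. [folklore] -/
def famX (i : Fin K) : CoefFam V nV :=
  CoefFam.ofFun 0 (fun l y => C.χ y * ⟪C.XV i y, FlatHData.bas l⟫_ℝ)
    (fun _ => C.contDiff_χ.mul ((C.hXV i).inner ℝ contDiff_const))
    (fun _ => C.hasCompactSupport_χ.mul_right)

/-- The family of `Y_l = (1 - χ̃) ∂_l`. [folklore] -/
def famY (k : Fin nV) : CoefFam V nV :=
  CoefFam.ofFun (fun l => if l = k then 1 else 0) (fun l y => if l = k then -C.χt y else 0)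
    (fun l => by by_cases h : l = k <;> simp [h, C.contDiff_χt.neg, contDiff_const])
    (fun l => by
      by_cases h : l = k
      · simp only [h, if_true]; exact C.hasCompactSupport_χt.neg
      · simp only [h, if_false]; exact HasCompactSupport.zero)

/-- The family of `-χ X₀`. [folklore] -/
def fam0 : CoefFam V nV :=
  CoefFam.ofFun 0 (fun l y => C.χ y * ⟪-C.XV0 y, FlatHData.bas l⟫_ℝ)
    (fun _ => C.contDiff_χ.mul (C.hXV0.neg.inner ℝ contDiff_const))
    (fun _ => C.hasCompactSupport_χ.mul_right)

/-- The avatar of `χ c`. [folklore] -/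
def bC : 𝓢(V, ℂ) :=
  ((C.hasCompactSupport_χ.mul_right (f' := C.cV)).comp_left Complex.ofReal_zero).toSchwartzMap
    (Complex.ofRealCLM.contDiff.comp (C.contDiff_χ.mul C.hcV))

/-- (structural lemma) [folklore] -/
theorem bC_apply (y : V) : C.bC y = ((C.χ y * C.cV y : ℝ) : ℂ) := rfl

/-- All sum-of-squares families: the `χ X_i` followed by the `Y_l`. [folklore] -/
def fams : Fin (K + nV) → CoefFam V nV := Fin.append C.famX C.famY

/-- **The globalised data of the chart.** [folklore] -/
def g : GData V where
  J := K + nV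
  fams := C.fams
  fam0 := C.fam0
  bC := C.bC
  bCreal := fun y => by rw [bC_apply]; exact Complex.conj_ofReal _
  pos := C.pos

/-- (structural lemma) [folklore] -/
@[simp] theorem g_J : C.g.J = K + nV := rfl
/-- (structural lemma) [folklore] -/
theorem g_fams : C.g.fams = C.fams := rfl
/-- (structural lemma) [folklore] -/
theorem fams_left (i : Fin K) : C.fams (Fin.castAdd nV i) = C.famX i := by simp [fams]
/-- (structural lemma) [folklore] -/
theorem fams_right (l : Fin nV) : C.fams (Fin.natAdd K l) = C.famY l := by simp [fams]

/-! #### The vector fields of the families -/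

/-- `vfR (famX i) = χ • X_i`. [folklore] -/
theorem vfR_famX (i : Fin K) (y : V) : vfR FlatHData.bas (C.famX i).fn y = C.χ y • C.XV i y := by
  unfold famX
  rw [vfR_ofFun]
  simp only [Pi.zero_apply, zero_add]
  have := vfR_coord (stdOrthonormalBasis ℝ V) (C.XV i) C.χ y
  unfold vfR at this
  simp only [Complex.ofReal_re] at this
  exact this

/-- `vfR fam0 = -χ • X₀`. [folklore] -/
theorem vfR_fam0 (y : V) : vfR FlatHData.bas C.fam0.fn y = -(C.χ y • C.XV0 y) := by
  unfold fam0
  rw [vfR_ofFun]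
  simp only [Pi.zero_apply, zero_add]
  have := vfR_coord (stdOrthonormalBasis ℝ V) (fun y => -C.XV0 y) C.χ y
  unfold vfR at this
  simp only [Complex.ofReal_re, smul_neg, inner_neg_left] at this ⊢
  exact this

/-- `vfR (famY k) = (1 - χ̃) • e_k`. [folklore] -/
theorem vfR_famY (k : Fin nV) (y : V) : vfR FlatHData.bas (C.famY k).fn y = (1 - C.χt y) • FlatHData.bas k := by
  unfold famY
  rw [vfR_ofFun, Finset.sum_eq_single k]
  · simp [sub_eq_add_neg]
  · intro l _ hl; simp [hl]
  · intro hk; exact absurd (Finset.mem_univ k) hk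

/-- The actual vector fields behind the families (`X_i` and `Y_l`). [folklore] -/
def XB : Fin (K + nV) → V → V := Fin.append C.XV fun l y => (1 - C.χt y) • FlatHData.bas l

/-- The same with the auxiliary fields replaced by zero (for the Gram construction, which must
not depend on the cutoffs). [folklore] -/
def XBz : Fin (K + nV) → V → V := Fin.append C.XV fun _ _ => 0

/-- Smoothness of `XB`. [folklore] -/
theorem contDiff_XB : ∀ j, ContDiff ℝ ∞ (C.XB j) := by
  intro j
  refine Fin.addCases (fun i => ?_) (fun l => ?_) j
  · simp only [XB, Fin.append_left]; exact C.hXV i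
  · simp only [XB, Fin.append_right]; exact (contDiff_const.sub C.contDiff_χt).smul contDiff_const

omit [FiniteDimensional ℝ V] in
/-- Smoothness of `XBz`. [folklore] -/
theorem contDiff_XBz : ∀ j, ContDiff ℝ ∞ (C.XBz j) := by
  intro j
  refine Fin.addCases (fun i => ?_) (fun l => ?_) j
  · simp only [XBz, Fin.append_left]; exact C.hXV i
  · simp only [XBz, Fin.append_right]; exact contDiff_const

/-- The big ball `B = ball y₀ 3δ`. [folklore] -/
def B : Set V := ball C.y₀ (3 * C.δ)

/-- `vfR (fams j) = XB j` on `B`. [folklore] -/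
theorem hbase : ∀ j, EqOn (vfR FlatHData.bas (C.fams j).fn) (C.XB j) C.B := by
  intro j
  refine Fin.addCases (fun i => ?_) (fun l => ?_) j
  · intro y hy
    rw [fams_left, vfR_famX, C.χ_eq_one hy, one_smul]
    simp [XB]
  · intro y _
    rw [fams_right, vfR_famY]
    simp [XB]

/-- `vfR fam0 = -X₀` on `B`. [folklore] -/
theorem hbase0 : EqOn (vfR FlatHData.bas C.fam0.fn) (fun y => -C.XV0 y) C.B := by
  intro y hy
  rw [vfR_fam0, C.χ_eq_one hy, one_smul]

/-! ### The globalised operator is Hörmander's transpose on the small ball -/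

/-- The `V`-side globalised operator on complex functions:
`H ↦ ∑_j X_j♭ (X_j♭ H) + X₀'♭ H + b_C H`. [folklore] -/
def PfV (H : V → ℂ) (y : V) : ℂ :=
  (∑ j, flatC FlatHData.bas (C.fams j).fn (flatC FlatHData.bas (C.fams j).fn H) y) +
    flatC FlatHData.bas C.fam0.fn H y + C.bC y * H y

omit [FiniteDimensional ℝ V] in
/-- `ᵗ(-X) = -ᵗX`. [folklore] -/
theorem fieldTranspose_neg_field (X : V → V) (f : V → ℝ) (y : V) :
    fieldTranspose (fun y => -X y) f y = -fieldTranspose X f y := by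
  simp only [fieldTranspose, fieldDeriv_apply, map_neg, fieldDiv]
  rw [show (fun y => -X y) = -X from rfl, fderiv_neg]
  simp only [ContinuousLinearMap.toLinearMap_neg, map_neg]
  ring

/-- `♭ (♭ F) = ᵗX (ᵗX F)` for the vector field of a real family. [folklore] -/
theorem flatC_flatC_ofReal {a : Fin nV → V → ℂ} (ha : RealFam a) (has : SmoothFam a) {F : V → ℝ}
    (hF : ContDiff ℝ ∞ F) (y : V) :
    flatC FlatHData.bas a (flatC FlatHData.bas a fun y => (F y : ℂ)) y =
      (fieldTranspose (vfR FlatHData.bas a) (fieldTranspose (vfR FlatHData.bas a) F) y : ℂ) := by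
  have hX : ContDiff ℝ ∞ (vfR FlatHData.bas a) := has.contDiff_vfR
  have hT : ContDiff ℝ ∞ (fieldTranspose (vfR FlatHData.bas a) F) := contDiff_fieldTranspose hX hF
  have e1 : (flatC FlatHData.bas a fun y => (F y : ℂ)) = fun y => ((-1 : ℂ)) * ((fieldTranspose (vfR FlatHData.bas a) F y : ℝ) : ℂ) := by
    ext y; rw [flatC_ofReal ha has hF]; ring
  rw [e1, flatC_const_mul has (-1) (h := fun y => ((fieldTranspose (vfR FlatHData.bas a) F y : ℝ) : ℂ))
    (Complex.ofRealCLM.contDiff.comp hT), flatC_ofReal ha has hT]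
  ring

/-- **On `ball y₀ δ` the globalised operator is Hörmander's transpose** of the data
`(X₀, X, c)`: `PfV F = ᵗP^V F` for real smooth `F`. [folklore] -/
theorem PfV_ofReal {F : V → ℝ} (hF : ContDiff ℝ ∞ F) {y : V} (hy : y ∈ ball C.y₀ C.δ) :
    C.PfV (fun y => (F y : ℂ)) y = (hormanderTranspose C.XV0 C.XV C.cV F y : ℂ) := by
  have hyB : y ∈ C.B := ball_subset_ball (by have := C.hδ; linarith) hy
  have hBo : IsOpen C.B := isOpen_ball
  unfold PfV hormanderTranspose
  rw [Fin.sum_univ_add]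
  -- the `X_i`
  have hXi : ∀ i : Fin K, flatC FlatHData.bas (C.fams (Fin.castAdd nV i)).fn
      (flatC FlatHData.bas (C.fams (Fin.castAdd nV i)).fn fun y => (F y : ℂ)) y =
        (fieldTranspose (C.XV i) (fieldTranspose (C.XV i) F) y : ℂ) := by
    intro i
    rw [flatC_flatC_ofReal (C.fams _).realFam (C.fams _).smooth hF]
    congr 1
    have hev : vfR FlatHData.bas (C.fams (Fin.castAdd nV i)).fn =ᶠ[𝓝 y] C.XV i := by
      have := (C.hbase (Fin.castAdd nV i))
      simp only [XB, Fin.append_left] at this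
      exact Filter.eventuallyEq_of_mem (hBo.mem_nhds hyB) this
    exact fieldTranspose_congr hev (fieldTranspose_eventuallyEq hev (Filter.EventuallyEq.refl _ F))
  -- the `Y_l` vanish near `y`
  have hYl : ∀ l : Fin nV, flatC FlatHData.bas (C.fams (Fin.natAdd K l)).fn
      (flatC FlatHData.bas (C.fams (Fin.natAdd K l)).fn fun y => (F y : ℂ)) y = 0 := by
    intro l
    rw [flatC_flatC_ofReal (C.fams _).realFam (C.fams _).smooth hF]
    have hev : vfR FlatHData.bas (C.fams (Fin.natAdd K l)).fn =ᶠ[𝓝 y] fun _ => 0 := by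
      have hball : ball C.y₀ C.δ ∈ 𝓝 y := isOpen_ball.mem_nhds hy
      filter_upwards [hball] with z hz
      rw [fams_right, vfR_famY, C.χt_eq_one hz, sub_self, zero_smul]
    rw [fieldTranspose_eq_zero_of_eventuallyEq hev]
    simp
  -- the drift
  have h0 : flatC FlatHData.bas C.fam0.fn (fun y => (F y : ℂ)) y = (fieldTranspose C.XV0 F y : ℂ) := by
    rw [flatC_ofReal C.fam0.realFam C.fam0.smooth hF]
    have hev : vfR FlatHData.bas C.fam0.fn =ᶠ[𝓝 y] fun y => -C.XV0 y :=
      Filter.eventuallyEq_of_mem (hBo.mem_nhds hyB) C.hbase0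
    rw [fieldTranspose_congr hev (Filter.EventuallyEq.refl _ F), fieldTranspose_neg_field]
    push_cast; ring
  simp only [hXi, hYl, Finset.sum_const_zero, add_zero, h0, bC_apply, C.χ_eq_one hyB, one_mul]
  push_cast
  ring

end Chart

/-! ### Spanning data from Gram coefficients -/

/-- Words using only the first `K` indices (the `X_i`, not the auxiliary `Y_l`). [folklore] -/
abbrev LowIdx {K n : ℕ} (w : BWord (K + n)) : Prop := BWord.IdxIn (fun j => (j : ℕ) < K) w

omit [FiniteDimensional ℝ V] in
/-- Word brackets of low words do not see the auxiliary fields. [folklore] -/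
theorem vbr_congr_low {K n : ℕ} {X X' : Fin (K + n) → V → V} (h : ∀ i : Fin K, X (Fin.castAdd n i) = X' (Fin.castAdd n i))
    (X0 : V → V) : ∀ w : BWord (K + n), LowIdx w → vbr X X0 w = vbr X' X0 w
  | BWord.base j, hj => by
    have : j = Fin.castAdd n ⟨j, hj⟩ := Fin.ext rfl
    simp only [vbr]; rw [this, h]
  | BWord.base0, _ => rfl
  | BWord.consJ j w, hj => by
    have : j = Fin.castAdd n ⟨j, hj.1⟩ := Fin.ext rfl
    simp only [vbr]; rw [vbr_congr_low h X0 w hj.2, this, h]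
  | BWord.cons0 w, hw => by simp only [vbr]; rw [vbr_congr_low h X0 w hw]

/-- `sgn0 w * sgn0 w = 1`. [folklore] -/
theorem sgn0_mul_self {J : ℕ} : ∀ w : BWord J, sgn0 w * sgn0 w = 1
  | BWord.base _ => by simp [sgn0]
  | BWord.base0 => by simp [sgn0]
  | BWord.consJ _ w => by simp only [sgn0]; exact sgn0_mul_self w
  | BWord.cons0 w => by simp only [sgn0, neg_mul_neg]; exact sgn0_mul_self w

namespace Chart

variable {K : ℕ} (C : Chart V K)

/-- **Gram input of the chart**: low words whose brackets (computed WITHOUT cutoffs) admit smooth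
spanning coefficients on `ball y₀ δ₀ ⊇ closedBall y₀ 2δ`. [folklore] -/
structure SpanIn (m : ℕ) where
  /-- the words [folklore] -/
  w : Fin m → BWord (K + nV)
  low : ∀ i, LowIdx (w i)
  /-- the Gram radius [folklore] -/
  δ₀ : ℝ
  /-- the Gram coefficients [folklore] -/
  gcoef : Fin nV → Fin m → V → ℝ
  hsmooth : ∀ k i, ∀ y ∈ ball C.y₀ δ₀, ContDiffAt ℝ ∞ (gcoef k i) y
  hsum : ∀ y ∈ ball C.y₀ δ₀, ∀ k, ∑ i, gcoef k i y • vbr C.XBz C.XV0 (w i) y = FlatHData.bas k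
  hδ₀ : 2 * C.δ < δ₀

variable {C} {m : ℕ} (S : C.SpanIn m)

namespace SpanIn

/-- The real coefficients `χ̃ · σ_i · g_{k,i}`. [folklore] -/
def bR (k : Fin nV) (i : Fin m) : V → ℝ := fun y => C.χt y * (sgn0 (S.w i) * S.gcoef k i y)

/-- They are smooth. [folklore] -/
theorem contDiff_bR (k : Fin nV) (i : Fin m) : ContDiff ℝ ∞ (S.bR k i) := by
  unfold bR
  refine contDiff_cutoff_mul C.contDiff_χt (U := ball C.y₀ S.δ₀) ?_ fun y hy => ?_
  · rw [C.tsupport_χt]; exact closedBall_subset_ball S.hδ₀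
  · exact contDiffAt_const.mul (S.hsmooth k i y hy)

/-- They are compactly supported. [folklore] -/
theorem hasCompactSupport_bR (k : Fin nV) (i : Fin m) : HasCompactSupport (S.bR k i) :=
  C.hasCompactSupport_χt.mul_right

/-- Their Schwartz avatars. [folklore] -/
def β (k : Fin nV) (i : Fin m) : 𝓢(V, ℂ) :=
  ((S.hasCompactSupport_bR k i).comp_left Complex.ofReal_zero).toSchwartzMap
    (Complex.ofRealCLM.contDiff.comp (S.contDiff_bR k i))

/-- (structural lemma) [folklore] -/
theorem β_apply (k : Fin nV) (i : Fin m) (y : V) : S.β k i y = (S.bR k i y : ℂ) := rfl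

/-- **The vector identity** `∑_i b_{k,i} · vfR (F_{w_i}) = χ̃ e_k`. [folklore] -/
theorem sum_bR_smul_vfR (k : Fin nV) (y : V) :
    ∑ i, S.bR k i y • vfR FlatHData.bas (Fw (e := FlatHData.bas) C.fams C.fam0 (S.w i)) y = C.χt y • FlatHData.bas k := by
  by_cases h0 : C.χt y = 0
  · simp [bR, h0]
  · have hy2 := C.mem_ball_of_χt_ne h0
    have hyB : y ∈ C.B := ball_subset_ball (by have := C.hδ; linarith) hy2
    have hyδ : y ∈ ball C.y₀ S.δ₀ := ball_subset_ball S.hδ₀.le hy2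
    have hFw : ∀ i, vfR FlatHData.bas (Fw (e := FlatHData.bas) C.fams C.fam0 (S.w i)) y =
        sgn0 (S.w i) • vbr C.XBz C.XV0 (S.w i) y := by
      intro i
      rw [vfR_Fw_eqOn C.contDiff_XB C.hXV0 isOpen_ball C.hbase C.hbase0 (S.w i) hyB]
      simp only
      rw [vbr_congr_low (X := C.XB) (X' := C.XBz) (fun i => by simp [Chart.XB, Chart.XBz]) C.XV0 (S.w i) (S.low i)]
    simp only [hFw, bR, smul_smul]
    have : ∀ i, C.χt y * (sgn0 (S.w i) * S.gcoef k i y) * sgn0 (S.w i) = C.χt y * S.gcoef k i y := fun i => by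
      have := sgn0_mul_self (S.w i)
      linear_combination (C.χt y * S.gcoef k i y) * this
    simp only [this, mul_smul, ← Finset.smul_sum]
    rw [S.hsum y hyδ k]

/-- **The coefficient identity** `Y_k + ∑_i β_i F_{w_i} = ∂_{e_k}`. [folklore] -/
theorem ident (k : Fin nV) (l : Fin nV) (y : V) :
    (C.fams (Fin.natAdd K k)).fn l y + ∑ i, S.β k i y * Fw (e := FlatHData.bas) C.fams C.fam0 (S.w i) l y =
      if l = k then 1 else 0 := by
  -- both sides are real; compare the real parts through the basis `bas`
  set u : Fin nV → ℂ := fun l => (C.fams (Fin.natAdd K k)).fn l y +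
    ∑ i, S.β k i y * Fw (e := FlatHData.bas) C.fams C.fam0 (S.w i) l y with hu
  have hreal : ∀ l, ((u l).re : ℂ) = u l := by
    intro l
    have hc : conj (u l) = u l := by
      simp only [hu, map_add, map_sum, map_mul, (C.fams _).realFam l y, S.β_apply, Complex.conj_ofReal,
        realFam_Fw (S.w _) l y]
    apply Complex.ext <;> simp [Complex.conj_eq_iff_im.1 hc]
  -- the vector identity for the real parts
  have hvec : ∑ l, (u l).re • FlatHData.bas (V := V) l = FlatHData.bas k := by
    have e1 : ∀ l, (u l).re = (1 - C.χt y) * (if l = k then 1 else 0) +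
        ∑ i, S.bR k i y * (Fw (e := FlatHData.bas) C.fams C.fam0 (S.w i) l y).re := by
      intro l
      simp only [hu, Complex.add_re, Complex.re_sum, S.β_apply, Complex.re_ofReal_mul, fams_right]
      congr 1
      simp only [Chart.famY, CoefFam.ofFun_fn, Complex.ofReal_re]
      split_ifs <;> ring
    simp only [e1, add_smul, Finset.sum_add_distrib, Finset.sum_smul]
    rw [Finset.sum_comm]
    have e2 : ∀ i, ∑ l, (S.bR k i y * (Fw (e := FlatHData.bas) C.fams C.fam0 (S.w i) l y).re) • FlatHData.bas (V := V) l =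
        S.bR k i y • vfR FlatHData.bas (Fw (e := FlatHData.bas) C.fams C.fam0 (S.w i)) y := fun i => by
      simp only [vfR, Finset.smul_sum, smul_smul]
    simp only [e2, S.sum_bR_smul_vfR]
    rw [Finset.sum_eq_single k]
    · simp [sub_smul]
    · intro l _ hl; simp [hl]
    · intro hk; exact absurd (Finset.mem_univ k) hk
  -- linear independence of the basis
  have hli := (stdOrthonormalBasis ℝ V).orthonormal.linearIndependent
  rw [Fintype.linearIndependent_iff] at hli
  have hdiff : ∑ l, ((u l).re - if l = k then 1 else 0) • FlatHData.bas (V := V) l = 0 := by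
    simp only [sub_smul, Finset.sum_sub_distrib, hvec]
    rw [Finset.sum_eq_single k]
    · simp [FlatHData.bas]
    · intro l _ hl; simp [hl]
    · intro hk; exact absurd (Finset.mem_univ k) hk
  have hl := hli _ hdiff l
  show u l = _
  rw [← hreal l, show (u l).re = if l = k then 1 else 0 from by linarith [hl]]
  split_ifs <;> simp

end SpanIn

/-- **The spanning data of the chart.** [folklore] -/
def spanData (k : Fin nV) : C.g.SpanData k where
  iY := Fin.natAdd K k
  m := m
  w := S.w
  β := S.β k
  cY := fun l => by
    show (C.fams (Fin.natAdd K k)).c l = _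
    rw [fams_right]; rfl
  βreal := fun i y => by rw [S.β_apply]; exact Complex.conj_ofReal _
  ident := fun l y => S.ident k l y

/-- **The spanning hypothesis of the chart's data.** [folklore] -/
theorem spanHyp [MeasurableSpace V] [BorelSpace V] : C.g.d.SpanHyp fun k => (C.spanData S k).L :=
  C.g.spanHyp fun k => C.spanData S k

end Chart

end Literature.Analysis.Hypoelliptic
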